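import Summits.CriticalPhenomena.PercolationContinuityZ3.Theorems.PercNearOneGluingNoHeavyQuantChiFEffective
import HarnessLib

/-!
# An EFFECTIVE GLOBAL modulus of continuity of `θ` on `[0, b]` (`b < 1`, `d ≥ 3`):
# `θ(p') − θ(p) ≤ θ(p_c + s + h) + (2d·K_d·exp((d+1)C/s²)/(1−b))·h` for `0 ≤ p ≤ p' ≤ b`, `p' − p ≤ h`, every `s > 0`

builds on p205010 (kernel theorem, internal audit signed; external expert review pending) — NOT used in the theorem (it
enters the READING only: with `θ(p_c) = 0`, hence `θ(p_c + t) → 0` as `t ↓ 0`, the right side tends to `0` as `h → 0` for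
`s = s(h) ↓ 0` slowly, e.g. `s(h) = √((d+1)C/log(1/√h))` makes the second term `O(√h)`; with the lane's explicit modulus
`knOmega d` (`Quant.thetaModulus_explicit_criticalProbI`) the whole right side is an explicit function of `h`).

Seat `prim-quant-p4` (METHOD = differential inequalities / near-critical regularity), gen 23; helper file
`--supports stmt-CriticalPhenomena-4575`; pure proofs, standard axioms.

The lane's (T2) rows bound `θ` at `p_c⁺` only; gen 8's Lipschitz continuity on compacts of `(p_c, 1)` had an existential
constant (Kesten–Zhang).  With the effective Lipschitz constant of `…QuantChiFEffective` (`theta_sub_theta_le_effective`: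
`L(a,b) = 2d·K_d·exp((d+1)C/(a−p_c)²)/(1−b)`, `K_d = 1 + 4|HOct d|(6d)^d`, `C = C(d)` Duminil-Copin–Kozma–Tassion's constant)
the two glue into ONE inequality valid for all `0 ≤ p ≤ p' ≤ b`: either `p' ≤ p_c + s + h` (then `θ(p') − θ(p) ≤ θ(p') ≤
θ(p_c + s + h)`, monotonicity) or both `p, p'` lie in `[p_c + s, b]` (Lipschitz).  New as typed (bookkeeping).

## References
* M. Aizenman, D. Barsky, Comm. Math. Phys. 108 (1987), (1.13) [AizenmanBarsky1987].
* H. Duminil-Copin, G. Kozma, V. Tassion, arXiv:1902.03207, Theorem 2 (p > p_c) [DuminilcopinKozmaTassion2020].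
* G. Grimmett, *Percolation*, 2nd ed. 1999, §8.7 (8.91), Thm. (8.92) [GrimmettPercolation1999].
-/

noncomputable section

namespace Summit.CriticalPhenomena.PercolationContinuityZ3.Theorems.SupercritXi

open MeasureTheory Filter Topology Literature.Probability.Percolation Literature.Probability.LatticeModels
open scoped Classical

variable {d : ℕ}

/-- **EFFECTIVE GLOBAL MODULUS OF `θ` ON `[0, b]`** (`d ≥ 3`, `b < 1`): with DKT's `C = C(d) > 0` and `K_d = 1 + 4|HOct d|(6d)^d`,
for every `s > 0` and `h ≥ 0` with `p_c + s + h ≤ 1` and all `0 ≤ p ≤ p' ≤ b` with `p' − p ≤ h`,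
`θ(p') − θ(p) ≤ θ(p_c + s + h) + (2d·K_d·exp((d+1)C/s²)/(1−b))·h`.
The infimum over `s` is a modulus of continuity of `θ` on `[0,b]` which is explicit modulo `θ` near `p_c⁺` (the lane's (T2) rows)
and tends to `0` with `h` iff `θ(p_c) = 0` (p205010).  New as typed (bookkeeping on `theta_sub_theta_le_effective`).
[cite: AizenmanBarsky1987, (1.13)] [cite: DuminilcopinKozmaTassion2020, Theorem 2 (p > p_c)] -/
theorem theta_sub_theta_le_global (hd : 3 ≤ d) :
    ∃ C : ℝ, 0 < C ∧ ∀ b : ℝ, b < 1 → ∀ s h : ℝ, 0 < s → 0 ≤ h →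
      ∀ p p' : ℝ, 0 ≤ p → p ≤ p' → p' ≤ b → p' - p ≤ h →
        theta (zdGraph d) 0 (GhostField.prm p') - theta (zdGraph d) 0 (GhostField.prm p) ≤
          theta (zdGraph d) 0 (GhostField.prm ((criticalProbI d : ℝ) + s + h)) +
            (2 * d * ((1 + 4 * Fintype.card (GM.HOct d) * (6 * d) ^ d) *
                Real.exp ((d + 1) * C / s ^ 2)) / (1 - b)) * h := by
  obtain ⟨C, hC, hLip⟩ := theta_sub_theta_le_effective (d := d) hd
  refine ⟨C, hC, fun b hb1 s h hs hh p p' hp0 hpp' hp'b hdiff => ?_⟩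
  set pc : ℝ := (criticalProbI d : ℝ) with hpc
  set K : ℝ := 1 + 4 * (Fintype.card (GM.HOct d) : ℝ) * (6 * d) ^ d with hK
  have hK0 : 0 ≤ K := by positivity
  have h1b : 0 < 1 - b := by linarith
  set L : ℝ := 2 * d * (K * Real.exp ((d + 1) * C / s ^ 2)) / (1 - b) with hL
  have hL0 : 0 ≤ L := by positivity
  have hθ0 : ∀ r : ℝ, 0 ≤ theta (zdGraph d) 0 (GhostField.prm r) := fun r => measureReal_nonneg
  rcases le_or_gt p' (pc + s + h) with hsmall | hlarge
  · -- both points below `p_c + s + h`: monotonicity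
    have hmono := ChiF.monotone_theta_prm (d := d) hsmall
    have : theta (zdGraph d) 0 (GhostField.prm p') - theta (zdGraph d) 0 (GhostField.prm p) ≤
        theta (zdGraph d) 0 (GhostField.prm (pc + s + h)) := by linarith [hθ0 p]
    linarith [mul_nonneg hL0 hh]
  · -- both points in `[p_c + s, b]`: the effective Lipschitz bound with `a = p_c + s`
    have ha : pc < pc + s := by linarith
    have hap : pc + s ≤ p := by linarith
    have hab : pc + s ≤ b := by linarith
    have key := hLip (pc + s) b ha hab hb1 p p' hap hpp' hp'b
    have hs2 : (pc + s - pc) ^ 2 = s ^ 2 := by ring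
    rw [hs2] at key
    have hLh : (2 * d * (K * Real.exp ((d + 1) * C / s ^ 2)) / (1 - b)) * (p' - p) ≤ L * h := by
      rw [← hL]; exact mul_le_mul_of_nonneg_left hdiff hL0
    linarith [hθ0 (pc + s + h)]

end Summit.CriticalPhenomena.PercolationContinuityZ3.Theorems.SupercritXi

end
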